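import Mathlib

/-!
# A spanning family of integral forms whose window matrix is independent mod `𝔭`

Stub `stub_localSpanningFamilyOfLattice` (S16) for the crux `HilbertIntegralOverconvergentIsCongruence`
(line Sketch-ideate-r1-k1).  The sup-norm Sturm principle of the line's engine needs, for the
space `V` of modular forms of a given weight over a field `𝕂` with coefficient functionals `c x`,
a finite family `b j` of `O`-integral forms spanning `V` whose window matrix `A j x = c x (b j)`
has rows linearly independent modulo a maximal ideal `𝔭` of `O`.  Here `O` (the ring of integers
of a number field) is not assumed to be principal, so the lattice `L` of `O`-integral forms need
not be free; we only use that it is finitely generated, spans `V`, is `𝔭`-saturated and satisfies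
Sturm's theorem modulo `𝔭` on the window `W`.

The proof: the quotient `L ⧸ 𝔭 • L` is a finite-dimensional vector space over the residue field
`O ⧸ 𝔭`; lift a basis of it to `ℓ j ∈ L` (`locSpan_exists_lift_basis`).  Independence of the
window matrix modulo `𝔭` follows from Sturm plus saturation (an `O`-combination `∑ y j • ℓ j` with
window coefficients in `𝔭` lies in `𝔭 • L`, so its image in `L ⧸ 𝔭 • L` vanishes and all `y j ∈ 𝔭`),
and the spanning property follows from Nakayama's lemma in the form
`Submodule.exists_sub_one_mem_and_smul_le_of_fg_of_le_sup`: some `r ≡ 1 (mod 𝔭)` multiplies `L`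
into the `O`-span of the `ℓ j`, and `r ≠ 0` in the field `𝕂`.
-/

set_option linter.dupNamespace false

namespace Summit.Langlands.Langlands.Theorems.HilbertIntegralOverconvergentIsCongruence

open Pointwise

/-- For a submodule `L ≤ M`, an ideal `I` and `f ∈ L`: `f ∈ I • ⊤` inside `L` iff `(f : M) ∈ I • L`
(transport along the injective inclusion `L.subtype`, using `Submodule.map_smul''`). -/
theorem locSpan_mem_smul_top_iff {R M : Type*} [CommRing R] [AddCommGroup M] [Module R M]
    (I : Ideal R) (L : Submodule R M) (f : L) :
    f ∈ (I • ⊤ : Submodule R L) ↔ (f : M) ∈ I • L := by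
  have hmap : (I • ⊤ : Submodule R L).map L.subtype = I • L := by
    rw [Submodule.map_smul'', Submodule.map_top, Submodule.range_subtype]
  rw [← Submodule.comap_map_eq_of_injective L.injective_subtype (I • ⊤ : Submodule R L),
    Submodule.mem_comap, hmap, Submodule.subtype_apply]

/-- **Lifting a basis of `M ⧸ 𝔭 M`.**  For a finite module `M` over a commutative ring `O` and a
maximal ideal `𝔭`, there is a finite family `ℓ : Fin n → M` (a lift of an `O ⧸ 𝔭`-basis of
`M ⧸ 𝔭 • M`) such that an `O`-combination `∑ y j • ℓ j` lies in `𝔭 • M` only if all `y j ∈ 𝔭`, and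
every `v ∈ M` is an `O`-combination of the `ℓ j` modulo `𝔭 • M`. -/
theorem locSpan_exists_lift_basis {O M : Type*} [CommRing O] [AddCommGroup M] [Module O M]
    [Module.Finite O M] (𝔭 : Ideal O) [𝔭.IsMaximal] :
    ∃ (n : ℕ) (ℓ : Fin n → M),
      (∀ y : Fin n → O, ∑ j, y j • ℓ j ∈ (𝔭 • ⊤ : Submodule O M) → ∀ j, y j ∈ 𝔭) ∧
      ∀ v : M, ∃ y : Fin n → O, v - ∑ j, y j • ℓ j ∈ (𝔭 • ⊤ : Submodule O M) := by
  classical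
  letI : Field (O ⧸ 𝔭) := Ideal.Quotient.field 𝔭
  -- an `O ⧸ 𝔭`-basis of the quotient `M ⧸ 𝔭 • M` and lifts of its elements
  let β := Module.finBasis (O ⧸ 𝔭) (M ⧸ (𝔭 • ⊤ : Submodule O M))
  choose ℓ hℓ using fun j => Submodule.mkQ_surjective (𝔭 • ⊤ : Submodule O M) (β j)
  -- the `O ⧸ 𝔭`-action on the quotient is induced by the `O`-action
  have hsmul : ∀ (r : O) (q : M ⧸ (𝔭 • ⊤ : Submodule O M)), r • q = Ideal.Quotient.mk 𝔭 r • q :=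
    fun _ _ => rfl
  have hmk : ∀ y : Fin _ → O, (𝔭 • ⊤ : Submodule O M).mkQ (∑ j, y j • ℓ j) =
      ∑ j, Ideal.Quotient.mk 𝔭 (y j) • β j := by
    intro y
    simp only [map_sum, map_smul, hℓ, hsmul]
  refine ⟨_, ℓ, ?_, ?_⟩
  · -- independence modulo `𝔭`, from the linear independence of `β`
    intro y hy j
    have h0 : ∑ j, Ideal.Quotient.mk 𝔭 (y j) • β j = 0 := by
      rw [← hmk, Submodule.mkQ_apply, Submodule.Quotient.mk_eq_zero]
      exact hy
    exact Ideal.Quotient.eq_zero_iff_mem.mp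
      (Fintype.linearIndependent_iff.mp β.linearIndependent (fun j => Ideal.Quotient.mk 𝔭 (y j))
        h0 j)
  · -- generation modulo `𝔭`, from `β` spanning the quotient
    intro v
    choose r hr using fun j =>
      Ideal.Quotient.mk_surjective (β.repr ((𝔭 • ⊤ : Submodule O M).mkQ v) j)
    refine ⟨r, ?_⟩
    have h : (𝔭 • ⊤ : Submodule O M).mkQ v = (𝔭 • ⊤ : Submodule O M).mkQ (∑ j, r j • ℓ j) := by
      rw [hmk]
      simp_rw [hr]
      exact (β.sum_repr _).symm
    rwa [Submodule.mkQ_apply, Submodule.mkQ_apply, Submodule.Quotient.eq] at h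

/-- **stub S16 — `stub_localSpanningFamilyOfLattice` (M/L; the integral structure ⇒ S14's hypothesis).**
`O` a commutative ring with a maximal ideal `𝔭`, `𝕂` an `O`-algebra that is a field with `O → 𝕂` injective,
`V` a finite-dimensional `𝕂`-space with coefficient functionals `c_x` SEPARATED by a finite window `W`
(`c_x f = 0` for `x ∈ W` ⇒ `f = 0`), and `L ⊆ V` an `O`-submodule which is finitely generated, spans `V` over
`𝕂`, has `O`-integral coefficients, is `𝔭`-SATURATED (`f ∈ L` with all `c_x f ∈ 𝔭` ⇒ `f ∈ 𝔭 • L`) and satisfies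
STURM mod `𝔭` (`f ∈ L` with `c_x f ∈ 𝔭` for `x ∈ W` ⇒ all `c_x f ∈ 𝔭`).  Then there is a finite family `b_j ∈ L`
spanning `V` whose window matrix `A j x = c_x(b_j) ∈ O` has rows independent mod `𝔭` in the sense of S14
(lift an `O ⧸ 𝔭`-basis of `L ⧸ 𝔭 • L`; independence from Sturm + saturation; span from Nakayama: some `a ≡ 1 (𝔭)`
kills `L /(Σ O b_j)`, and `a ≠ 0` in `𝕂`).  The separation hypothesis and finite-dimensionality are not
needed for this statement. [folklore] -/
theorem stub_localSpanningFamilyOfLattice {O 𝕂 V X : Type*} [CommRing O] [Field 𝕂] [Algebra O 𝕂]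
    (hinj : Function.Injective (algebraMap O 𝕂)) [AddCommGroup V] [Module 𝕂 V] [Module O V]
    [IsScalarTower O 𝕂 V] [FiniteDimensional 𝕂 V] (𝔭 : Ideal O) [𝔭.IsMaximal]
    (c : X → V →ₗ[𝕂] 𝕂) (W : Finset X) (_hsep : ∀ f : V, (∀ x ∈ W, c x f = 0) → f = 0)
    (L : Submodule O V) (hLfg : L.FG) (hLspan : ⊤ ≤ Submodule.span 𝕂 (L : Set V))
    (hLint : ∀ f ∈ L, ∀ x, ∃ a : O, algebraMap O 𝕂 a = c x f)
    (hLsat : ∀ f ∈ L, (∀ x, ∃ a ∈ 𝔭, algebraMap O 𝕂 a = c x f) → f ∈ 𝔭 • L)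
    (hSturm : ∀ f ∈ L, (∀ x ∈ W, ∃ a ∈ 𝔭, algebraMap O 𝕂 a = c x f) →
      ∀ x, ∃ a ∈ 𝔭, algebraMap O 𝕂 a = c x f) :
    ∃ (n : ℕ) (b : Fin n → V) (A : Fin n → X → O), (∀ j, b j ∈ L) ∧ ⊤ ≤ Submodule.span 𝕂 (Set.range b) ∧
      (∀ j x, algebraMap O 𝕂 (A j x) = c x (b j)) ∧
      ∀ y : Fin n → O, (∀ x ∈ W, ∑ j, y j * A j x ∈ 𝔭) → ∀ j, y j ∈ 𝔭 := by
  classical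
  haveI : Module.Finite O L := Module.Finite.iff_fg.mpr hLfg
  -- lift an `O ⧸ 𝔭`-basis of `L ⧸ 𝔭 • L` to `ℓ j ∈ L`, and choose the integral window entries
  obtain ⟨n, ℓ, hind, hgen⟩ := locSpan_exists_lift_basis (M := L) 𝔭
  choose A hA using fun j x => hLint (ℓ j : V) (ℓ j).2 x
  -- `O`-combinations of the `ℓ j`, in `L` and in `V`
  have hcoe : ∀ y : Fin n → O, ((∑ j, y j • ℓ j : L) : V) = ∑ j, y j • (ℓ j : V) := by
    intro y
    simp only [Submodule.coe_sum, Submodule.coe_smul]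
  have hmem : ∀ y : Fin n → O, ∑ j, y j • (ℓ j : V) ∈ L :=
    fun y => Submodule.sum_mem _ fun j _ => Submodule.smul_mem _ _ (ℓ j).2
  -- the window coefficients of an `O`-combination
  have hc : ∀ (y : Fin n → O) (x : X),
      c x (∑ j, y j • (ℓ j : V)) = algebraMap O 𝕂 (∑ j, y j * A j x) := by
    intro y x
    simp only [map_sum, map_mul, hA]
    refine Finset.sum_congr rfl fun j _ => ?_
    rw [← algebraMap_smul 𝕂 (y j), map_smul, smul_eq_mul]
  refine ⟨n, fun j => (ℓ j : V), A, fun j => (ℓ j).2, ?_, hA, ?_⟩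
  · -- spanning: Nakayama's lemma
    have hle : L ≤ Submodule.span O (Set.range fun j => (ℓ j : V)) ⊔ 𝔭 • L := by
      intro v hv
      obtain ⟨y, hy⟩ := hgen ⟨v, hv⟩
      simp only [locSpan_mem_smul_top_iff, Submodule.coe_sub, hcoe] at hy
      rw [Submodule.mem_sup]
      refine ⟨∑ j, y j • (ℓ j : V), ?_, v - ∑ j, y j • (ℓ j : V), hy, add_sub_cancel _ _⟩
      exact Submodule.sum_mem _ fun j _ =>
        Submodule.smul_mem _ _ (Submodule.subset_span ⟨j, rfl⟩)
    obtain ⟨r, hr1, hrL⟩ := Submodule.exists_sub_one_mem_and_smul_le_of_fg_of_le_sup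
      (I := 𝔭) (N := Submodule.span O (Set.range fun j => (ℓ j : V))) hLfg le_rfl hle
    have hr𝔭 : r ∉ 𝔭 := fun h =>
      Ideal.IsMaximal.ne_top ‹_› ((Ideal.eq_top_iff_one _).mpr (by simpa using 𝔭.sub_mem h hr1))
    have hr0 : algebraMap O 𝕂 r ≠ 0 := by
      rw [map_ne_zero_iff _ hinj]
      rintro rfl
      exact hr𝔭 𝔭.zero_mem
    have hLsub : (L : Set V) ⊆ Submodule.span 𝕂 (Set.range fun j => (ℓ j : V)) := by
      intro v hv
      have h1 : r • v ∈ Submodule.span O (Set.range fun j => (ℓ j : V)) :=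
        hrL (Submodule.smul_mem_pointwise_smul v r L hv)
      have h2 : algebraMap O 𝕂 r • v ∈ Submodule.span 𝕂 (Set.range fun j => (ℓ j : V)) := by
        rw [algebraMap_smul]
        exact Submodule.span_le_restrictScalars O 𝕂 _ h1
      rw [SetLike.mem_coe, ← inv_smul_smul₀ hr0 v]
      exact Submodule.smul_mem _ _ h2
    exact hLspan.trans (Submodule.span_le.mpr hLsub)
  · -- independence modulo `𝔭`: Sturm, saturation, and the choice of `ℓ`
    intro y hy j
    refine hind y ?_ j
    rw [locSpan_mem_smul_top_iff, hcoe]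
    refine hLsat _ (hmem y) (hSturm _ (hmem y) fun x hx => ?_)
    exact ⟨_, hy x hx, (hc y x).symm⟩

end Summit.Langlands.Langlands.Theorems.HilbertIntegralOverconvergentIsCongruence
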